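import Mathlib
import Summits.KontsevichZagierPeriods.KontsevichZagierPeriods.Theorems.InverseLandauTateFamilyKernelTateAnchor
import Summits.KontsevichZagierPeriods.KontsevichZagierPeriods.Theorems.InverseLandauTateFamilyKernelStubEulerAnchor
import Summits.KontsevichZagierPeriods.KontsevichZagierPeriods.Theorems.InverseLandauTateFamilyKernelStubEulerFaces
import Summits.KontsevichZagierPeriods.KontsevichZagierPeriods.Theorems.InverseLandauTateFamilyKernelStubEulerBandExact

/-!
# Crux `TateFamilyKernel` (stmt-KontsevichZagierPeriods-9130), line `Sketch` — glue
# `qhPencil_mem_relations_of_faceExact` (wave 12, Euler sector, conditional on face exactness)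

The SINGLE-WEIGHT quasi-homogeneous pencil of the lead's skeleton of the crux
`Summit.KontsevichZagierPeriods.KontsevichZagierPeriods.Theses.InverseLandau.TateFamilyKernel`,
modulo the exactness of the one-variable face family (step (C′), next). Data: weights `a, b`, an
exponent `d ≥ 1`, `T, P₀ ∈ ℚ[z₀, z₁]` weighted-homogeneous of degrees `d`, `w`, `λ = w + a + b ≥ 1`,
a real-algebraic `ϖ₀ > 0` with `1 − ϖ T(z) ≠ 0` on `[0,1]² × [0, ϖ₀] ∋ (z, ϖ)`, and a rational
`s`-primitive `Em/Ed` of the face family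
`j(s, ϖ) = aP₀(1,s)/(1 − ϖT(1,s)) + bP₀(s,1)/(1 − ϖT(s,1))` along `ϖ = ϖ₀t^d`, pole-free on the
square, with equal endpoint values. Conclusion: every tame cube representation `Φ` of the fibre
`P₀/(1 − ϖ₀T)` is a Kontsevich–Zagier relation.

Composition of the three landed steps of the Euler sector:

* (A) `stub_eulerAnchor` — `[Φ] − [r] ∈ KZ.relations` for the tame cube `r` on `[0,1]³` with
  integrand `t^{λ−1}·(λP₀Q + dϖP₀T)/Q²` at `ϖ = ϖ₀t^d` (Tate-anchored Newton–Leibniz in `t`);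
* (B) `stub_eulerFaces` — `[r] − [rb] ∈ KZ.relations` for the tame cube `rb` on `[0,1]²` with
  integrand the weighted face band `t^{λ−1}·[aP₀(1,s)Q_b + bP₀(s,1)Q_a]/(Q_aQ_b)` (divergence
  theorem on the 3-cube, via `stub_eulerDivergence`);
* (C) `stub_eulerBandExact` — `[rb] ∈ KZ.relations` (one Ayoub element in `s`, given `Em/Ed`).

The two intermediate tame cubes exist by `exists_isTameCube_fibre` (file
`InverseLandauTateFamilyKernelTateAnchor.lean`: the slice at `ϖ₀` of a quotient of `ℚ`-polynomials
whose denominator does not vanish on the closed cube is analytic near it and `ℚ`-semialgebraic on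
it). The only new input is bookkeeping: the three admissibility hypotheses of (A)–(C) — for the
4-variable reparametrised pencil `1 − X₃X₂^d T` on `[0,1]³` and for its two faces `z₀ = 1`, `z₁ = 1` on
`[0,1]²` — follow from the 2-parameter admissibility on `[0,1]² × [0, ϖ₀]`, because
`ϖ₀u^d ∈ [0, ϖ₀]` for `u ∈ [0,1]` (`QhPencil.adm_cube_three`, `QhPencil.adm_face_zero`,
`QhPencil.adm_face_one`).

References: Kontsevich–Zagier 2001, §1.2 rules (1)–(3); Ayoub, EMS Newsl. 91 (2014), Def. 10.
Mathlib plus the landed sibling files; no named fact, no new definition. Helpers live in the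
sub-namespace `QhPencil`.
-/

noncomputable section

open MeasureTheory Set MvPolynomial
open Literature.NumberTheory.Transcendental

namespace Summit.KontsevichZagierPeriods.InverseLandau.TateFamilyKernel.Descent

namespace QhPencil

/-- The reparametrised parameter `ϖ₀u^d` lies in `[0, ϖ₀]` for `u ∈ [0,1]` and `ϖ₀ > 0`. [folklore] -/
theorem mul_pow_mem_Icc {ϖ₀ u : ℝ} (hϖ₀ : 0 < ϖ₀) (hu : 0 ≤ u ∧ u ≤ 1) (d : ℕ) :
    ϖ₀ * u ^ d ∈ Icc (0 : ℝ) ϖ₀ :=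
  ⟨mul_nonneg hϖ₀.le (pow_nonneg hu.1 d), mul_le_of_le_one_right hϖ₀.le (pow_le_one₀ hu.1 hu.2)⟩

/-- A point of the plane with both coordinates in `[0,1]` lies in the closed square. [folklore] -/
theorem vec_mem_cube_two {u v : ℝ} (hu : 0 ≤ u ∧ u ≤ 1) (hv : 0 ≤ v ∧ v ≤ 1) :
    (![u, v] : Fin 2 → ℝ) ∈ KZ.cube 2 := by
  refine KZ.mem_cube.2 fun i => ?_
  fin_cases i
  · simpa using hu
  · simpa using hv

/-- **Admissibility of the reparametrised 4-variable pencil.** If `1 − ϖT(z) ≠ 0` for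
`z ∈ [0,1]²`, `ϖ ∈ [0, ϖ₀]` (`ϖ₀ > 0`), then `1 − ϖ₀t^dT(z) ≠ 0` on `[0,1]³ ∋ (z, t)`:
the 4-variable datum `1 − X₃X₂^d·T` does not vanish at `(x, ϖ₀)`, `x ∈ [0,1]³`. [folklore] -/
theorem adm_cube_three {T : MvPolynomial (Fin 2) ℚ} {ϖ₀ : ℝ} (d : ℕ) (hϖ₀ : 0 < ϖ₀)
    (hadm : ∀ z ∈ KZ.cube 2, ∀ ϖ ∈ Icc (0 : ℝ) ϖ₀, 1 - ϖ * aeval z T ≠ 0) (x : Fin 3 → ℝ)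
    (hx : x ∈ KZ.cube 3) :
    aeval (Fin.snoc x ϖ₀ : Fin (3 + 1) → ℝ)
      (1 - X 3 * X 2 ^ d * rename (Fin.castLE (show 2 ≤ 4 by norm_num)) T) ≠ 0 := by
  have h := hadm _ (vec_mem_cube_two (KZ.mem_cube.1 hx 0) (KZ.mem_cube.1 hx 1)) _
    (mul_pow_mem_Icc hϖ₀ (KZ.mem_cube.1 hx 2) d)
  simpa only [map_sub, map_mul, map_pow, map_one, aeval_X, EulerFaces.snoc_apply_two,
    EulerFaces.snoc_apply_three, EulerFaces.aeval_snoc_rename_castLE, mul_assoc] using h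

/-- **Admissibility on the face `z₀ = 1`.** If `1 − ϖT(z) ≠ 0` for `z ∈ [0,1]²`, `ϖ ∈ [0, ϖ₀]`
(`ϖ₀ > 0`), then `Q_a = 1 − ϖ₀t^dT(1, s) ≠ 0` for `(s, t) ∈ [0,1]²`: the 3-variable face datum
`1 − X₂X₁^d·T(1, X₀)` does not vanish at `(y, ϖ₀)`, `y ∈ [0,1]²`. [folklore] -/
theorem adm_face_zero {T : MvPolynomial (Fin 2) ℚ} {ϖ₀ : ℝ} (d : ℕ) (hϖ₀ : 0 < ϖ₀)
    (hadm : ∀ z ∈ KZ.cube 2, ∀ ϖ ∈ Icc (0 : ℝ) ϖ₀, 1 - ϖ * aeval z T ≠ 0) (y : Fin 2 → ℝ)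
    (hy : y ∈ KZ.cube 2) :
    aeval (Fin.snoc y ϖ₀ : Fin (2 + 1) → ℝ) (1 - X 2 * X 1 ^ d * bind₁ ![C 1, X 0] T) ≠ 0 := by
  have h := hadm _ (vec_mem_cube_two ⟨zero_le_one, le_rfl⟩ (KZ.mem_cube.1 hy 0)) _
    (mul_pow_mem_Icc hϖ₀ (KZ.mem_cube.1 hy 1) d)
  simpa only [map_sub, map_mul, map_pow, map_one, aeval_X, EulerFaces.aeval_bind₁_pair,
    EulerDivergence.snoc_apply_zero, EulerDivergence.snoc_apply_one,
    EulerDivergence.snoc_apply_two, mul_assoc] using h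

/-- **Admissibility on the face `z₁ = 1`.** If `1 − ϖT(z) ≠ 0` for `z ∈ [0,1]²`, `ϖ ∈ [0, ϖ₀]`
(`ϖ₀ > 0`), then `Q_b = 1 − ϖ₀t^dT(s, 1) ≠ 0` for `(s, t) ∈ [0,1]²`: the 3-variable face datum
`1 − X₂X₁^d·T(X₀, 1)` does not vanish at `(y, ϖ₀)`, `y ∈ [0,1]²`. [folklore] -/
theorem adm_face_one {T : MvPolynomial (Fin 2) ℚ} {ϖ₀ : ℝ} (d : ℕ) (hϖ₀ : 0 < ϖ₀)
    (hadm : ∀ z ∈ KZ.cube 2, ∀ ϖ ∈ Icc (0 : ℝ) ϖ₀, 1 - ϖ * aeval z T ≠ 0) (y : Fin 2 → ℝ)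
    (hy : y ∈ KZ.cube 2) :
    aeval (Fin.snoc y ϖ₀ : Fin (2 + 1) → ℝ) (1 - X 2 * X 1 ^ d * bind₁ ![X 0, C 1] T) ≠ 0 := by
  have h := hadm _ (vec_mem_cube_two (KZ.mem_cube.1 hy 0) ⟨zero_le_one, le_rfl⟩) _
    (mul_pow_mem_Icc hϖ₀ (KZ.mem_cube.1 hy 1) d)
  simpa only [map_sub, map_mul, map_pow, map_one, aeval_X, EulerFaces.aeval_bind₁_pair,
    EulerDivergence.snoc_apply_zero, EulerDivergence.snoc_apply_one,
    EulerDivergence.snoc_apply_two, mul_assoc] using h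

end QhPencil

/-- **Quasi-homogeneous pencils, single weight, modulo the exactness of the face family** (wave 12
of the line = the strategist's Euler sector): for `T, P₀` weighted-homogeneous and `Q = 1 − ϖT`
admissible on `[0,1]² × [0,ϖ₀]`, a rational `s`-primitive of the one-variable face family
`aP₀(1,s)/(1−ϖT(1,s)) + bP₀(s,1)/(1−ϖT(s,1))` along `ϖ = ϖ₀t^d` with equal endpoint values makes
every tame-cube representation of the fibre `P₀/(1−ϖ₀T)` a KZ relation — Tate-anchored
Newton–Leibniz in `t` (`stub_eulerAnchor`), divergence theorem (`stub_eulerFaces`, via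
`stub_eulerDivergence`), one Ayoub element in `s` (`stub_eulerBandExact`). The vanishing of the
period function enters only through the face primitive ((C′), next).
[cite: KontsevichZagier2001, §1.2] -/
theorem qhPencil_mem_relations_of_faceExact (a b d w : ℕ) (hd : 0 < d) (hl : 1 ≤ w + a + b)
    (T P₀ : MvPolynomial (Fin 2) ℚ)
    (hT : T.IsWeightedHomogeneous (![a, b] : Fin 2 → ℕ) d) (hP : P₀.IsWeightedHomogeneous (![a, b] : Fin 2 → ℕ) w)
    (ϖ₀ : ℝ) (halg : IsAlgebraic ℚ ϖ₀) (hϖ₀ : 0 < ϖ₀)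
    (hadm : ∀ z ∈ KZ.cube 2, ∀ ϖ ∈ Icc (0 : ℝ) ϖ₀, 1 - ϖ * aeval z T ≠ 0)
    (Em Ed : MvPolynomial (Fin (1 + 1)) ℚ)
    (hEd : ∀ y ∈ KZ.cube 2, aeval (Fin.snoc y ϖ₀ : Fin (2 + 1) → ℝ) (bind₁ ![X 0, X 2 * X 1 ^ d] Ed) ≠ 0)
    (hE : ∀ y ∈ KZ.cube 2,
      HasDerivAt (fun σ : ℝ =>
          aeval (Fin.snoc (![σ, y 1] : Fin 2 → ℝ) ϖ₀ : Fin (2 + 1) → ℝ) (bind₁ ![X 0, X 2 * X 1 ^ d] Em) /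
            aeval (Fin.snoc (![σ, y 1] : Fin 2 → ℝ) ϖ₀ : Fin (2 + 1) → ℝ) (bind₁ ![X 0, X 2 * X 1 ^ d] Ed))
        (aeval (Fin.snoc y ϖ₀ : Fin (2 + 1) → ℝ)
            (C (a : ℚ) * bind₁ ![C 1, X 0] P₀ * (1 - X 2 * X 1 ^ d * bind₁ ![X 0, C 1] T) +
              C (b : ℚ) * bind₁ ![X 0, C 1] P₀ * (1 - X 2 * X 1 ^ d * bind₁ ![C 1, X 0] T)) /
          aeval (Fin.snoc y ϖ₀ : Fin (2 + 1) → ℝ)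
            ((1 - X 2 * X 1 ^ d * bind₁ ![C 1, X 0] T) * (1 - X 2 * X 1 ^ d * bind₁ ![X 0, C 1] T)))
        (y 0))
    (hE01 : ∀ t ∈ Icc (0 : ℝ) 1,
      aeval (Fin.snoc (![1, t] : Fin 2 → ℝ) ϖ₀ : Fin (2 + 1) → ℝ) (bind₁ ![X 0, X 2 * X 1 ^ d] Em) /
          aeval (Fin.snoc (![1, t] : Fin 2 → ℝ) ϖ₀ : Fin (2 + 1) → ℝ) (bind₁ ![X 0, X 2 * X 1 ^ d] Ed) =
        aeval (Fin.snoc (![0, t] : Fin 2 → ℝ) ϖ₀ : Fin (2 + 1) → ℝ) (bind₁ ![X 0, X 2 * X 1 ^ d] Em) /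
          aeval (Fin.snoc (![0, t] : Fin 2 → ℝ) ϖ₀ : Fin (2 + 1) → ℝ) (bind₁ ![X 0, X 2 * X 1 ^ d] Ed))
    (Φ : KZ.IntegralRep 2) (hΦ : Φ.IsTameCube)
    (hΦi : ∀ z ∈ KZ.cube 2, Φ.integrand z =
      aeval (Fin.snoc z ϖ₀ : Fin (2 + 1) → ℝ) (rename Fin.castSucc P₀) /
        aeval (Fin.snoc z ϖ₀ : Fin (2 + 1) → ℝ) (1 - X 2 * rename Fin.castSucc T)) :
    KZ.of Φ ∈ KZ.relations := by
  -- admissibility of the reparametrised pencil on `[0,1]³` and of its two faces on `[0,1]²`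
  have hadm4 : ∀ x ∈ KZ.cube 3, aeval (Fin.snoc x ϖ₀ : Fin (3 + 1) → ℝ)
      (1 - X 3 * X 2 ^ d * rename (Fin.castLE (show 2 ≤ 4 by norm_num)) T) ≠ 0 :=
    QhPencil.adm_cube_three d hϖ₀ hadm
  have hadmA : ∀ y ∈ KZ.cube 2, aeval (Fin.snoc y ϖ₀ : Fin (2 + 1) → ℝ)
      (1 - X 2 * X 1 ^ d * bind₁ ![C 1, X 0] T) ≠ 0 :=
    QhPencil.adm_face_zero d hϖ₀ hadm
  have hadmB : ∀ y ∈ KZ.cube 2, aeval (Fin.snoc y ϖ₀ : Fin (2 + 1) → ℝ)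
      (1 - X 2 * X 1 ^ d * bind₁ ![X 0, C 1] T) ≠ 0 :=
    QhPencil.adm_face_one d hϖ₀ hadm
  -- (A) the tame cube `r` on `[0,1]³`: integrand `t^{λ−1}·(λP₀Q + dϖP₀T)/Q²` at `ϖ = ϖ₀t^d`
  have hQ2 : ∀ x ∈ KZ.cube 3, aeval (Fin.snoc x ϖ₀ : Fin (3 + 1) → ℝ)
      ((1 - X 3 * X 2 ^ d * rename (Fin.castLE (show 2 ≤ 4 by norm_num)) T) ^ 2) ≠ 0 :=
    fun x hx => by
      rw [map_pow]
      exact pow_ne_zero 2 (hadm4 x hx)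
  obtain ⟨r, hr, hri⟩ := exists_isTameCube_fibre
    (X 2 ^ (w + a + b - 1) *
      (C ((w + a + b : ℕ) : ℚ) * rename (Fin.castLE (show 2 ≤ 4 by norm_num)) P₀ *
          (1 - X 3 * X 2 ^ d * rename (Fin.castLE (show 2 ≤ 4 by norm_num)) T) +
        C ((d : ℕ) : ℚ) * X 3 * X 2 ^ d * rename (Fin.castLE (show 2 ≤ 4 by norm_num)) P₀ *
          rename (Fin.castLE (show 2 ≤ 4 by norm_num)) T))
    _ halg hQ2
  have h₁ : KZ.of Φ - KZ.of r ∈ KZ.relations :=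
    stub_eulerAnchor a b d w hd hl T P₀ ϖ₀ halg hadm4 Φ hΦ hΦi r hr (fun x _ => by rw [hri])
  -- (B) the tame face band `rb` on `[0,1]²`
  have hQab : ∀ y ∈ KZ.cube 2, aeval (Fin.snoc y ϖ₀ : Fin (2 + 1) → ℝ)
      ((1 - X 2 * X 1 ^ d * bind₁ ![C 1, X 0] T) * (1 - X 2 * X 1 ^ d * bind₁ ![X 0, C 1] T)) ≠ 0 :=
    fun y hy => by
      rw [map_mul]
      exact mul_ne_zero (hadmA y hy) (hadmB y hy)
  obtain ⟨rb, hrb, hrbi⟩ := exists_isTameCube_fibre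
    (X 1 ^ (w + a + b - 1) *
      (C (a : ℚ) * bind₁ ![C 1, X 0] P₀ * (1 - X 2 * X 1 ^ d * bind₁ ![X 0, C 1] T) +
        C (b : ℚ) * bind₁ ![X 0, C 1] P₀ * (1 - X 2 * X 1 ^ d * bind₁ ![C 1, X 0] T)))
    _ halg hQab
  have h₂ : KZ.of r - KZ.of rb ∈ KZ.relations :=
    stub_eulerFaces a b d w hd hl T P₀ hT hP ϖ₀ halg hadm4 r hr (fun x _ => by rw [hri]) rb hrb
      (fun y _ => by rw [hrbi])
  -- (C) the exact face band is a relation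
  have h₃ : KZ.of rb ∈ KZ.relations :=
    stub_eulerBandExact a b d w hd hl T P₀ ϖ₀ halg hadmA hadmB rb hrb (fun y _ => by rw [hrbi])
      Em Ed hEd hE hE01
  have : KZ.of Φ = (KZ.of Φ - KZ.of r) + (KZ.of r - KZ.of rb) + KZ.of rb := by abel
  rw [this]
  exact KZ.relations.add_mem (KZ.relations.add_mem h₁ h₂) h₃

end Summit.KontsevichZagierPeriods.InverseLandau.TateFamilyKernel.Descent

end
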